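import Summits.AnomalousDissipation.AnomalousDissipation.Theorems.MarginalStabilityChainStrainedLayerLawClockLine
import Summits.AnomalousDissipation.AnomalousDissipation.Theorems.MarginalStabilityChainStrainedLayerLawStubVorticityUniformBoundsE

/-!
# Stub `stub_negEnstrophyLaw` of line `FirstLemmasR2K4` (log-enstrophy clock; crux `MarginalStabilityChain.StrainedLayerLaw`,
# stmt-AnomalousDissipation-3007) — tools A: the smooth convex regularisation `F_ε` of `s ↦ s₋²`

Support file (`--supports stmt-AnomalousDissipation-3007`; registered sub-goal `stub_negEnstrophyLaw_toolsA`, the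
conjunction of the calculus facts below). The negative-enstrophy law `Ω₋′ = Ω₋ − 2νP₋` of the line is the weak vorticity
balance of the stretched layer (tools D of p120637) tested against `Φ = F′(ω)ψ` for `F(s) = s₋² = max(−s,0)²`; since
`F′ = −2s₋` is only Lipschitz, `F` is replaced by the `C²` regularisation (with `j_ε(s) = √(s² + ε²)`, tools E)

  `F_ε(s) = (s² − s j_ε(s))/2`,  `F_ε′(s) = s − j_ε/2 − s²/(2j_ε) = −(j_ε − s)²/(2j_ε)`,
  `F_ε″(s) = 1 − s/j_ε − sε²/(2(s²+ε²)j_ε) = (1 − r)²(2 + r)/2`, `r = s/j_ε`,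
  `G_ε(s) = sF_ε′(s) − F_ε(s) = s²(j_ε − s)/(2j_ε)`.

This file proves: the two derivative identities, `F_ε′ ∈ C¹`, `F_ε″` continuous, the bounds `|F_ε| ≤ |s|(|s| + ε)`,
`|F_ε′| ≤ 2(|s| + ε)`, `0 ≤ F_ε″ ≤ 2`, `0 ≤ G_ε ≤ s²`, and the limits as `ε → 0⁺`: `F_ε(s), G_ε(s) → s₋²`,
`F_ε″(s) → 2` for `s < 0`, `F_ε″(s) → 0` for `s > 0`. All `[folklore]` (elementary calculus).
-/

-- `Summit.<Summit>.<Problem>` is the tree's mandated summit-side namespace (CONVENTIONS §2); for this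
-- single-conjunct summit the two coincide, so the duplicate is deliberate.
set_option linter.dupNamespace false

noncomputable section

open scoped Topology ENNReal
open Filter Set Function MeasureTheory

namespace Summit.AnomalousDissipation.AnomalousDissipation.Theorems.StrainedLayerLaw.LogEnstrophyClock

open Literature.Analysis.FluidPDE Literature.Analysis.FluidPDE.StretchedLayer
open Summit.AnomalousDissipation.AnomalousDissipation.Theses.MarginalStabilityChain
open Summit.AnomalousDissipation.AnomalousDissipation.Theorems.StrainedLayerLaw.StrainWorkSumRule

/-! ## The regularisation `F_ε(s) = (s² − s√(s² + ε²))/2` of `s₋²` -/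

section Modulus

/-- `F_ε′`: the derivative of `F_ε(s) = (s² − s j_ε)/2` is `s − j_ε/2 − s(s/j_ε)/2` (`ε > 0`). [folklore] -/
theorem clock_F_hasDerivAt {ε : ℝ} (hε : 0 < ε) (s : ℝ) :
    HasDerivAt (fun s => (s ^ 2 - s * Real.sqrt (s ^ 2 + ε ^ 2)) / 2)
      (s - Real.sqrt (s ^ 2 + ε ^ 2) / 2 - s * (s / Real.sqrt (s ^ 2 + ε ^ 2)) / 2) s := by
  obtain ⟨-, -, -, -, -, -, -, -, -, hj, -, -⟩ := kato_modulus_props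
  have h1 : HasDerivAt (fun s : ℝ => s ^ 2) (2 * s) s := by simpa using hasDerivAt_pow 2 s
  have h := (h1.sub ((hasDerivAt_id' s).mul (hj hε s))).div_const 2
  refine h.congr_deriv ?_
  ring

/-- `F_ε″`: the derivative of `F_ε′(s) = s − j_ε/2 − s(s/j_ε)/2` is `1 − s/j_ε − s·(ε²/((s² + ε²)j_ε))/2`. [folklore] -/
theorem clock_Fp_hasDerivAt {ε : ℝ} (hε : 0 < ε) (s : ℝ) :
    HasDerivAt (fun s => s - Real.sqrt (s ^ 2 + ε ^ 2) / 2 - s * (s / Real.sqrt (s ^ 2 + ε ^ 2)) / 2)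
      (1 - s / Real.sqrt (s ^ 2 + ε ^ 2) -
        s * (ε ^ 2 / ((s ^ 2 + ε ^ 2) * Real.sqrt (s ^ 2 + ε ^ 2))) / 2) s := by
  obtain ⟨-, -, -, -, -, -, -, -, -, hj, hjp, -⟩ := kato_modulus_props
  have h := ((hasDerivAt_id' s).sub ((hj hε s).div_const 2)).sub (((hasDerivAt_id' s).mul (hjp hε s)).div_const 2)
  refine h.congr_deriv ?_
  ring

/-- `F_ε′ ∈ C¹(ℝ)` (`ε > 0`). [folklore] -/
theorem clock_Fp_contDiff {ε : ℝ} (hε : 0 < ε) :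
    ContDiff ℝ 1 (fun s : ℝ => s - Real.sqrt (s ^ 2 + ε ^ 2) / 2 - s * (s / Real.sqrt (s ^ 2 + ε ^ 2)) / 2) := by
  obtain ⟨hp, hr, -⟩ := kato_modulus_props
  have hj : ContDiff ℝ 1 (fun s : ℝ => Real.sqrt (s ^ 2 + ε ^ 2)) :=
    ContDiff.sqrt (by fun_prop) fun s => (hp hε s).ne'
  have hjp : ContDiff ℝ 1 (fun s : ℝ => s / Real.sqrt (s ^ 2 + ε ^ 2)) :=
    contDiff_id.div hj fun s => (hr hε s).ne'
  exact (contDiff_id.sub (hj.div_const 2)).sub ((contDiff_id.mul hjp).div_const 2)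

/-- `F_ε` is continuous. [folklore] -/
theorem clock_F_continuous (ε : ℝ) :
    Continuous (fun s : ℝ => (s ^ 2 - s * Real.sqrt (s ^ 2 + ε ^ 2)) / 2) :=
  ((continuous_pow 2).sub (continuous_id.mul (Real.continuous_sqrt.comp (by fun_prop)))).div_const 2

/-- `F_ε′` is continuous (`ε > 0`). [folklore] -/
theorem clock_Fp_continuous {ε : ℝ} (hε : 0 < ε) :
    Continuous (fun s : ℝ => s - Real.sqrt (s ^ 2 + ε ^ 2) / 2 - s * (s / Real.sqrt (s ^ 2 + ε ^ 2)) / 2) :=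
  (clock_Fp_contDiff hε).continuous

/-- `F_ε″` is continuous (`ε > 0`). [folklore] -/
theorem clock_Fpp_continuous {ε : ℝ} (hε : 0 < ε) :
    Continuous (fun s : ℝ => 1 - s / Real.sqrt (s ^ 2 + ε ^ 2) -
      s * (ε ^ 2 / ((s ^ 2 + ε ^ 2) * Real.sqrt (s ^ 2 + ε ^ 2))) / 2) := by
  obtain ⟨hp, hr, -⟩ := kato_modulus_props
  have cj : Continuous fun s : ℝ => Real.sqrt (s ^ 2 + ε ^ 2) := Real.continuous_sqrt.comp (by fun_prop)
  have cjp : Continuous fun s : ℝ => s / Real.sqrt (s ^ 2 + ε ^ 2) := continuous_id.div cj fun s => (hr hε s).ne'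
  have cjpp : Continuous fun s : ℝ => ε ^ 2 / ((s ^ 2 + ε ^ 2) * Real.sqrt (s ^ 2 + ε ^ 2)) :=
    continuous_const.div ((by fun_prop : Continuous fun s : ℝ => s ^ 2 + ε ^ 2).mul cj)
      fun s => (mul_pos (hp hε s) (hr hε s)).ne'
  exact (continuous_const.sub cjp).sub ((continuous_id.mul cjpp).div_const 2)

/-- `|F_ε(s)| ≤ |s|(|s| + ε)` (`ε > 0`): `F_ε(ω)` decays like `|ω|`. [folklore] -/
theorem clock_F_abs_le {ε : ℝ} (hε : 0 < ε) (s : ℝ) :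
    |(s ^ 2 - s * Real.sqrt (s ^ 2 + ε ^ 2)) / 2| ≤ |s| * (|s| + ε) := by
  obtain ⟨-, hr, -, habs, hle, -⟩ := kato_modulus_props
  have hj0 := hr hε s
  have h1 : |s ^ 2 - s * Real.sqrt (s ^ 2 + ε ^ 2)| ≤ s ^ 2 + |s| * Real.sqrt (s ^ 2 + ε ^ 2) := by
    calc |s ^ 2 - s * Real.sqrt (s ^ 2 + ε ^ 2)| ≤ |s ^ 2| + |s * Real.sqrt (s ^ 2 + ε ^ 2)| := abs_sub _ _
      _ = s ^ 2 + |s| * Real.sqrt (s ^ 2 + ε ^ 2) := by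
          rw [abs_of_nonneg (sq_nonneg s), abs_mul, abs_of_pos hj0]
  have h2 : |s| * Real.sqrt (s ^ 2 + ε ^ 2) ≤ |s| * (|s| + ε) :=
    mul_le_mul_of_nonneg_left (hle hε s) (abs_nonneg s)
  have h3 : s ^ 2 = |s| * |s| := by rw [← sq, sq_abs]
  rw [abs_div, abs_two]
  nlinarith [abs_nonneg s, hε.le]

/-- `|F_ε′(s)| ≤ 2(|s| + ε)` (`ε > 0`). [folklore] -/
theorem clock_Fp_abs_le {ε : ℝ} (hε : 0 < ε) (s : ℝ) :
    |s - Real.sqrt (s ^ 2 + ε ^ 2) / 2 - s * (s / Real.sqrt (s ^ 2 + ε ^ 2)) / 2| ≤ 2 * (|s| + ε) := by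
  obtain ⟨hp, hr, -, habs, hle, -⟩ := kato_modulus_props
  have hj0 := hr hε s
  have hj2 : Real.sqrt (s ^ 2 + ε ^ 2) ^ 2 = s ^ 2 + ε ^ 2 := Real.sq_sqrt (hp hε s).le
  have e : s * (s / Real.sqrt (s ^ 2 + ε ^ 2)) = s ^ 2 / Real.sqrt (s ^ 2 + ε ^ 2) := by rw [sq]; ring
  have h5 : s ^ 2 / Real.sqrt (s ^ 2 + ε ^ 2) ≤ Real.sqrt (s ^ 2 + ε ^ 2) := by
    rw [div_le_iff₀ hj0, ← sq, hj2]; nlinarith [sq_nonneg ε]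
  calc |s - Real.sqrt (s ^ 2 + ε ^ 2) / 2 - s * (s / Real.sqrt (s ^ 2 + ε ^ 2)) / 2|
      ≤ |s - Real.sqrt (s ^ 2 + ε ^ 2) / 2| + |s * (s / Real.sqrt (s ^ 2 + ε ^ 2)) / 2| := abs_sub _ _
    _ ≤ (|s| + |Real.sqrt (s ^ 2 + ε ^ 2) / 2|) + |s * (s / Real.sqrt (s ^ 2 + ε ^ 2)) / 2| := by
        gcongr; exact abs_sub _ _
    _ = |s| + Real.sqrt (s ^ 2 + ε ^ 2) / 2 + s ^ 2 / Real.sqrt (s ^ 2 + ε ^ 2) / 2 := by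
        rw [e, abs_of_nonneg (by positivity : (0:ℝ) ≤ Real.sqrt (s ^ 2 + ε ^ 2) / 2),
          abs_of_nonneg (by positivity : (0:ℝ) ≤ s ^ 2 / Real.sqrt (s ^ 2 + ε ^ 2) / 2)]
    _ ≤ 2 * (|s| + ε) := by linarith [hle hε s, abs_nonneg s]

/-- `F_ε″ = (2 − 3r + r³)/2` with `r = s/j_ε` (`ε > 0`). [folklore] -/
theorem clock_Fpp_eq {ε : ℝ} (hε : 0 < ε) (s : ℝ) :
    1 - s / Real.sqrt (s ^ 2 + ε ^ 2) - s * (ε ^ 2 / ((s ^ 2 + ε ^ 2) * Real.sqrt (s ^ 2 + ε ^ 2))) / 2 =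
      (2 - 3 * (s / Real.sqrt (s ^ 2 + ε ^ 2)) + (s / Real.sqrt (s ^ 2 + ε ^ 2)) ^ 3) / 2 := by
  obtain ⟨hp, hr, -⟩ := kato_modulus_props
  set j : ℝ := Real.sqrt (s ^ 2 + ε ^ 2) with hj
  have hj0 : 0 < j := hr hε s
  have hj2 : j ^ 2 = s ^ 2 + ε ^ 2 := by rw [hj]; exact Real.sq_sqrt (hp hε s).le
  rw [← hj2, show ε ^ 2 = j ^ 2 - s ^ 2 by rw [hj2]; ring]
  field_simp
  ring

/-- `0 ≤ F_ε″` (convexity of `F_ε`; `F_ε″ = (1 − r)²(2 + r)/2`, `|r| ≤ 1`). [folklore] -/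
theorem clock_Fpp_nonneg {ε : ℝ} (hε : 0 < ε) (s : ℝ) :
    0 ≤ 1 - s / Real.sqrt (s ^ 2 + ε ^ 2) - s * (ε ^ 2 / ((s ^ 2 + ε ^ 2) * Real.sqrt (s ^ 2 + ε ^ 2))) / 2 := by
  obtain ⟨-, -, -, -, -, hjp1, -⟩ := kato_modulus_props
  rw [clock_Fpp_eq hε]
  obtain ⟨h1, h2⟩ := abs_le.1 (hjp1 hε s)
  set r : ℝ := s / Real.sqrt (s ^ 2 + ε ^ 2)
  have key : 2 - 3 * r + r ^ 3 = (1 - r) ^ 2 * (2 + r) := by ring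
  rw [key]
  have : 0 ≤ (1 - r) ^ 2 * (2 + r) := mul_nonneg (sq_nonneg _) (by linarith)
  linarith

/-- `F_ε″ ≤ 2` (`4 − (2 − 3r + r³) = (1 + r)²(2 − r) ≥ 0`, `|r| ≤ 1`). [folklore] -/
theorem clock_Fpp_le_two {ε : ℝ} (hε : 0 < ε) (s : ℝ) :
    1 - s / Real.sqrt (s ^ 2 + ε ^ 2) - s * (ε ^ 2 / ((s ^ 2 + ε ^ 2) * Real.sqrt (s ^ 2 + ε ^ 2))) / 2 ≤ 2 := by
  obtain ⟨-, -, -, -, -, hjp1, -⟩ := kato_modulus_props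
  rw [clock_Fpp_eq hε]
  obtain ⟨h1, h2⟩ := abs_le.1 (hjp1 hε s)
  set r : ℝ := s / Real.sqrt (s ^ 2 + ε ^ 2)
  have key : 2 - 3 * r + r ^ 3 = 4 - (1 + r) ^ 2 * (2 - r) := by ring
  rw [key]
  have : 0 ≤ (1 + r) ^ 2 * (2 - r) := mul_nonneg (sq_nonneg _) (by linarith)
  linarith

/-- `|F_ε″| ≤ 2`. [folklore] -/
theorem clock_Fpp_abs_le {ε : ℝ} (hε : 0 < ε) (s : ℝ) :
    |1 - s / Real.sqrt (s ^ 2 + ε ^ 2) - s * (ε ^ 2 / ((s ^ 2 + ε ^ 2) * Real.sqrt (s ^ 2 + ε ^ 2))) / 2| ≤ 2 := by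
  rw [abs_of_nonneg (clock_Fpp_nonneg hε s)]; exact clock_Fpp_le_two hε s

/-- `G_ε = sF_ε′ − F_ε = (s²/2)(1 − s/j_ε)`. [folklore] -/
theorem clock_G_eq (ε s : ℝ) :
    s * (s - Real.sqrt (s ^ 2 + ε ^ 2) / 2 - s * (s / Real.sqrt (s ^ 2 + ε ^ 2)) / 2) -
        (s ^ 2 - s * Real.sqrt (s ^ 2 + ε ^ 2)) / 2 =
      s ^ 2 / 2 * (1 - s / Real.sqrt (s ^ 2 + ε ^ 2)) := by
  ring

/-- `0 ≤ G_ε(s)` (`ε > 0`). [folklore] -/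
theorem clock_G_nonneg {ε : ℝ} (hε : 0 < ε) (s : ℝ) :
    0 ≤ s * (s - Real.sqrt (s ^ 2 + ε ^ 2) / 2 - s * (s / Real.sqrt (s ^ 2 + ε ^ 2)) / 2) -
        (s ^ 2 - s * Real.sqrt (s ^ 2 + ε ^ 2)) / 2 := by
  obtain ⟨-, -, -, -, -, hjp1, -⟩ := kato_modulus_props
  rw [clock_G_eq]
  obtain ⟨h1, h2⟩ := abs_le.1 (hjp1 hε s)
  exact mul_nonneg (by positivity) (by linarith)

/-- `G_ε(s) ≤ s²` (`ε > 0`). [folklore] -/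
theorem clock_G_le_sq {ε : ℝ} (hε : 0 < ε) (s : ℝ) :
    s * (s - Real.sqrt (s ^ 2 + ε ^ 2) / 2 - s * (s / Real.sqrt (s ^ 2 + ε ^ 2)) / 2) -
        (s ^ 2 - s * Real.sqrt (s ^ 2 + ε ^ 2)) / 2 ≤ s ^ 2 := by
  obtain ⟨-, -, -, -, -, hjp1, -⟩ := kato_modulus_props
  rw [clock_G_eq]
  obtain ⟨h1, h2⟩ := abs_le.1 (hjp1 hε s)
  nlinarith [sq_nonneg s]

/-- `|G_ε(s)| ≤ s²` (`ε > 0`). [folklore] -/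
theorem clock_G_abs_le {ε : ℝ} (hε : 0 < ε) (s : ℝ) :
    |s * (s - Real.sqrt (s ^ 2 + ε ^ 2) / 2 - s * (s / Real.sqrt (s ^ 2 + ε ^ 2)) / 2) -
        (s ^ 2 - s * Real.sqrt (s ^ 2 + ε ^ 2)) / 2| ≤ s ^ 2 := by
  rw [abs_of_nonneg (clock_G_nonneg hε s)]; exact clock_G_le_sq hε s

/-! ## The limits `ε → 0⁺` -/

/-- `j_ε(s) → |s|` as `ε → 0⁺`. [folklore] -/
theorem clock_j_tendsto (s : ℝ) :
    Tendsto (fun ε : ℝ => Real.sqrt (s ^ 2 + ε ^ 2)) (𝓝[>] 0) (𝓝 |s|) := by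
  have h : Tendsto (fun ε : ℝ => Real.sqrt (s ^ 2 + ε ^ 2)) (𝓝 0) (𝓝 (Real.sqrt (s ^ 2 + 0 ^ 2))) :=
    (Real.continuous_sqrt.comp (by fun_prop : Continuous fun ε : ℝ => s ^ 2 + ε ^ 2)).tendsto 0
  rw [zero_pow two_ne_zero, add_zero, Real.sqrt_sq_eq_abs] at h
  exact h.mono_left nhdsWithin_le_nhds

/-- `(s² − s|s|)/2 = s₋²`. [folklore] -/
theorem clock_sq_sub_mul_abs (s : ℝ) : (s ^ 2 - s * |s|) / 2 = (max (-s) 0) ^ 2 := by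
  rcases le_or_gt 0 s with h | h
  · rw [abs_of_nonneg h, max_eq_right (by linarith)]; ring
  · rw [abs_of_neg h, max_eq_left (by linarith)]; ring

/-- `F_ε(s) → s₋² = max(−s, 0)²` as `ε → 0⁺`. [folklore] -/
theorem clock_F_tendsto (s : ℝ) :
    Tendsto (fun ε : ℝ => (s ^ 2 - s * Real.sqrt (s ^ 2 + ε ^ 2)) / 2) (𝓝[>] 0) (𝓝 ((max (-s) 0) ^ 2)) := by
  have h := ((tendsto_const_nhds (x := s ^ 2)).sub ((tendsto_const_nhds (x := s)).mul (clock_j_tendsto s))).div_const 2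
  rwa [clock_sq_sub_mul_abs] at h

/-- `s/j_ε(s) → s/|s|` as `ε → 0⁺` for `s ≠ 0`. [folklore] -/
theorem clock_jp_tendsto {s : ℝ} (hs : s ≠ 0) :
    Tendsto (fun ε : ℝ => s / Real.sqrt (s ^ 2 + ε ^ 2)) (𝓝[>] 0) (𝓝 (s / |s|)) :=
  (tendsto_const_nhds (x := s)).div (clock_j_tendsto s) (abs_ne_zero.2 hs)

/-- `G_ε(s) → s₋²` as `ε → 0⁺`. [folklore] -/
theorem clock_G_tendsto (s : ℝ) :
    Tendsto (fun ε : ℝ => s * (s - Real.sqrt (s ^ 2 + ε ^ 2) / 2 - s * (s / Real.sqrt (s ^ 2 + ε ^ 2)) / 2) -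
        (s ^ 2 - s * Real.sqrt (s ^ 2 + ε ^ 2)) / 2) (𝓝[>] 0) (𝓝 ((max (-s) 0) ^ 2)) := by
  simp only [clock_G_eq]
  rcases eq_or_ne s 0 with rfl | hs
  · simp
  · have h := ((tendsto_const_nhds (x := (1:ℝ))).sub (clock_jp_tendsto hs)).const_mul (s ^ 2 / 2)
    have e : s ^ 2 / 2 * (1 - s / |s|) = (max (-s) 0) ^ 2 := by
      rcases lt_or_gt_of_ne hs with h' | h'
      · rw [abs_of_neg h', max_eq_left (by linarith), div_neg, div_self hs]; ring
      · rw [abs_of_pos h', max_eq_right (by linarith), div_self hs]; ring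
    rwa [e] at h

/-- `ε²/((s² + ε²)j_ε(s)) → 0` as `ε → 0⁺` for `s ≠ 0`. [folklore] -/
theorem clock_jpp_tendsto {s : ℝ} (hs : s ≠ 0) :
    Tendsto (fun ε : ℝ => ε ^ 2 / ((s ^ 2 + ε ^ 2) * Real.sqrt (s ^ 2 + ε ^ 2))) (𝓝[>] 0) (𝓝 0) := by
  have h1 : Tendsto (fun ε : ℝ => ε ^ 2) (𝓝[>] (0:ℝ)) (𝓝 0) := by
    have h : Tendsto (fun ε : ℝ => ε ^ 2) (𝓝 (0:ℝ)) (𝓝 (0 ^ 2)) := (continuous_pow 2).tendsto 0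
    rw [zero_pow two_ne_zero] at h
    exact h.mono_left nhdsWithin_le_nhds
  have h2 : Tendsto (fun ε : ℝ => (s ^ 2 + ε ^ 2) * Real.sqrt (s ^ 2 + ε ^ 2)) (𝓝[>] (0:ℝ))
      (𝓝 ((s ^ 2 + 0) * |s|)) := ((tendsto_const_nhds (x := s ^ 2)).add h1).mul (clock_j_tendsto s)
  have hne : (s ^ 2 + 0) * |s| ≠ 0 := by
    rw [add_zero]; exact mul_ne_zero (pow_ne_zero 2 hs) (abs_ne_zero.2 hs)
  have h := h1.div h2 hne
  rwa [zero_div] at h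

/-- `F_ε″(s) → 2` as `ε → 0⁺` for `s < 0`. [folklore] -/
theorem clock_Fpp_tendsto_of_neg {s : ℝ} (hs : s < 0) :
    Tendsto (fun ε : ℝ => 1 - s / Real.sqrt (s ^ 2 + ε ^ 2) -
      s * (ε ^ 2 / ((s ^ 2 + ε ^ 2) * Real.sqrt (s ^ 2 + ε ^ 2))) / 2) (𝓝[>] 0) (𝓝 2) := by
  have h := ((tendsto_const_nhds (x := (1:ℝ))).sub (clock_jp_tendsto hs.ne)).sub
    (((tendsto_const_nhds (x := s)).mul (clock_jpp_tendsto hs.ne)).div_const 2)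
  have e : (1:ℝ) - s / |s| - s * 0 / 2 = 2 := by
    rw [abs_of_neg hs, div_neg, div_self hs.ne]; ring
  rwa [e] at h

/-- `F_ε″(s) → 0` as `ε → 0⁺` for `s > 0`. [folklore] -/
theorem clock_Fpp_tendsto_of_pos {s : ℝ} (hs : 0 < s) :
    Tendsto (fun ε : ℝ => 1 - s / Real.sqrt (s ^ 2 + ε ^ 2) -
      s * (ε ^ 2 / ((s ^ 2 + ε ^ 2) * Real.sqrt (s ^ 2 + ε ^ 2))) / 2) (𝓝[>] 0) (𝓝 0) := by
  have h := ((tendsto_const_nhds (x := (1:ℝ))).sub (clock_jp_tendsto hs.ne')).sub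
    (((tendsto_const_nhds (x := s)).mul (clock_jpp_tendsto hs.ne')).div_const 2)
  have e : (1:ℝ) - s / |s| - s * 0 / 2 = 0 := by
    rw [abs_of_pos hs, div_self hs.ne']; ring
  rwa [e] at h

end Modulus

/-! ## The registered sub-goal: the calculus of `F_ε`, bundled -/

/-- **Tools A for `stub_negEnstrophyLaw` (registered sub-goal `stub_negEnstrophyLaw_toolsA`).** The calculus of the
regularisation `F_ε(s) = (s² − s√(s² + ε²))/2` of `s₋²`, bundled: for `ε > 0`, the derivative identities
`F_ε′ = s − j_ε/2 − s(s/j_ε)/2`, `F_ε″ = 1 − s/j_ε − s·ε²/(2(s² + ε²)j_ε)`, the bounds `|F_ε| ≤ |s|(|s| + ε)`,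
`|F_ε′| ≤ 2(|s| + ε)`, `0 ≤ F_ε″ ≤ 2`, `0 ≤ G_ε = sF_ε′ − F_ε ≤ s²`, and the limits `F_ε(s), G_ε(s) → s₋²`,
`F_ε″(s) → 2` (`s < 0`), `F_ε″(s) → 0` (`s > 0`) as `ε → 0⁺`. [folklore] -/
theorem stub_negEnstrophyLaw_toolsA :
    (∀ {ε : ℝ}, 0 < ε → ∀ s : ℝ, HasDerivAt (fun s => (s ^ 2 - s * Real.sqrt (s ^ 2 + ε ^ 2)) / 2)
      (s - Real.sqrt (s ^ 2 + ε ^ 2) / 2 - s * (s / Real.sqrt (s ^ 2 + ε ^ 2)) / 2) s) ∧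
    (∀ {ε : ℝ}, 0 < ε → ∀ s : ℝ,
      HasDerivAt (fun s => s - Real.sqrt (s ^ 2 + ε ^ 2) / 2 - s * (s / Real.sqrt (s ^ 2 + ε ^ 2)) / 2)
        (1 - s / Real.sqrt (s ^ 2 + ε ^ 2) -
          s * (ε ^ 2 / ((s ^ 2 + ε ^ 2) * Real.sqrt (s ^ 2 + ε ^ 2))) / 2) s) ∧
    (∀ {ε : ℝ}, 0 < ε → ∀ s : ℝ, |(s ^ 2 - s * Real.sqrt (s ^ 2 + ε ^ 2)) / 2| ≤ |s| * (|s| + ε)) ∧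
    (∀ {ε : ℝ}, 0 < ε → ∀ s : ℝ,
      |s - Real.sqrt (s ^ 2 + ε ^ 2) / 2 - s * (s / Real.sqrt (s ^ 2 + ε ^ 2)) / 2| ≤ 2 * (|s| + ε)) ∧
    (∀ {ε : ℝ}, 0 < ε → ∀ s : ℝ, 0 ≤ 1 - s / Real.sqrt (s ^ 2 + ε ^ 2) -
      s * (ε ^ 2 / ((s ^ 2 + ε ^ 2) * Real.sqrt (s ^ 2 + ε ^ 2))) / 2) ∧
    (∀ {ε : ℝ}, 0 < ε → ∀ s : ℝ, 1 - s / Real.sqrt (s ^ 2 + ε ^ 2) -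
      s * (ε ^ 2 / ((s ^ 2 + ε ^ 2) * Real.sqrt (s ^ 2 + ε ^ 2))) / 2 ≤ 2) ∧
    (∀ {ε : ℝ}, 0 < ε → ∀ s : ℝ,
      0 ≤ s * (s - Real.sqrt (s ^ 2 + ε ^ 2) / 2 - s * (s / Real.sqrt (s ^ 2 + ε ^ 2)) / 2) -
        (s ^ 2 - s * Real.sqrt (s ^ 2 + ε ^ 2)) / 2) ∧
    (∀ {ε : ℝ}, 0 < ε → ∀ s : ℝ,
      s * (s - Real.sqrt (s ^ 2 + ε ^ 2) / 2 - s * (s / Real.sqrt (s ^ 2 + ε ^ 2)) / 2) -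
        (s ^ 2 - s * Real.sqrt (s ^ 2 + ε ^ 2)) / 2 ≤ s ^ 2) ∧
    (∀ s : ℝ, Tendsto (fun ε : ℝ => (s ^ 2 - s * Real.sqrt (s ^ 2 + ε ^ 2)) / 2) (𝓝[>] 0)
      (𝓝 ((max (-s) 0) ^ 2))) ∧
    (∀ s : ℝ, Tendsto (fun ε : ℝ =>
      s * (s - Real.sqrt (s ^ 2 + ε ^ 2) / 2 - s * (s / Real.sqrt (s ^ 2 + ε ^ 2)) / 2) -
        (s ^ 2 - s * Real.sqrt (s ^ 2 + ε ^ 2)) / 2) (𝓝[>] 0) (𝓝 ((max (-s) 0) ^ 2))) ∧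
    (∀ {s : ℝ}, s < 0 → Tendsto (fun ε : ℝ => 1 - s / Real.sqrt (s ^ 2 + ε ^ 2) -
      s * (ε ^ 2 / ((s ^ 2 + ε ^ 2) * Real.sqrt (s ^ 2 + ε ^ 2))) / 2) (𝓝[>] 0) (𝓝 2)) ∧
    (∀ {s : ℝ}, 0 < s → Tendsto (fun ε : ℝ => 1 - s / Real.sqrt (s ^ 2 + ε ^ 2) -
      s * (ε ^ 2 / ((s ^ 2 + ε ^ 2) * Real.sqrt (s ^ 2 + ε ^ 2))) / 2) (𝓝[>] 0) (𝓝 0)) :=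
  ⟨fun hε s => clock_F_hasDerivAt hε s, fun hε s => clock_Fp_hasDerivAt hε s, fun hε s => clock_F_abs_le hε s,
    fun hε s => clock_Fp_abs_le hε s, fun hε s => clock_Fpp_nonneg hε s, fun hε s => clock_Fpp_le_two hε s,
    fun hε s => clock_G_nonneg hε s, fun hε s => clock_G_le_sq hε s, clock_F_tendsto, clock_G_tendsto,
    fun hs => clock_Fpp_tendsto_of_neg hs, fun hs => clock_Fpp_tendsto_of_pos hs⟩

end Summit.AnomalousDissipation.AnomalousDissipation.Theorems.StrainedLayerLaw.LogEnstrophyClock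

end
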